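import Literature.NumberTheory.IwasawaTheory.CyclotomicTwoTowerOddPrimeDecompositionExact
import Literature.NumberTheory.IwasawaTheory.ImaginaryQuadraticTwoTowerGenusRankAnyCyclotomic
import Literature.NumberTheory.IwasawaTheory.CyclotomicTwoTotallyRamifiedNoSqrtTwo
import Literature.NumberTheory.IwasawaTheory.ClassicalLambdaLeStableRank
import Literature.NumberTheory.GaloisRepresentations.SplitsCompletelyCriteria
import HarnessLib

/-!
# The `2`-rank of the class group is EVENTUALLY CONSTANT in the cyclotomic `ℤ₂`-tower of an imaginary quadratic field with odd discriminant:
# `rank₂ Cl(K_n) = Σ_{ℓ ∣ d_K} 2^{min(n, ord₂(ℓ²−1)−3)} − 1`, stationary at the Ferrero–Kida number `Σ_{ℓ ∣ d_K} 2^{ord₂(ℓ²−1)−3} − 1`;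
# hence `μ₂(K) = 0` and **`λ₂(K) ≤ Σ_{ℓ ∣ d_K} 2^{ord₂(ℓ²−1)−3} − 1`** UNCONDITIONALLY (proved; no definition, no named fact)

Topic `NumberTheory/IwasawaTheory` (namespace = path).  THEOREM-ONLY file, written by the prover seat `bsd-line-att-p3` g30 (cell `bsd-f1-sign2`;
`--supports` stmt-BirchSwinnertonDyer-22298; closes nothing).  Assembles this seat's genus count (`ImaginaryQuadraticTwoTowerGenusRank[AnyCyclotomic]`:
`rank₂ Cl(K_n) = t_n − 1`, `t_n = Σ_{ℓ ∣ d_K} g_n(ℓ)`) with the exact decomposition law (`CyclotomicTwoTowerOddPrimeDecompositionExact`: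
`g_n(ℓ) = 2^{min(n, ord₂(ℓ²−1)−3)}`) and the tree's Fukuda package (`ClassicalLambdaLeStableRank`: a rank certificate `r_{n+1} = r_n` at a layer past
the Fukuda index gives `μ = 0` and `λ ≤ r_n`; index `0` here by `CyclotomicTwoTotallyRamifiedNoSqrtTwo`, `2` being unramified in `K`).

* §1 `classGroupPRank_cyclotomic_two_eq_sum_two_pow_min` — **`rank₂ Cl(K_n) = Σ_{ℓ ∣ d_K} 2^{min(n, ord₂(ℓ²−1)−3)} − 1`** (every `n`, every cyclotomic `κK`);
  `classGroupPRank_cyclotomic_two_eq_of_le` — for `n ≥ n₀(K) := max_{ℓ ∣ d_K} (ord₂(ℓ²−1)−3)`: **`rank₂ Cl(K_n) = Σ_{ℓ ∣ d_K} 2^{ord₂(ℓ²−1)−3} − 1`**;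
  `classGroupPRank_cyclotomic_two_succ_eq_of_le` — the RESOLVENT'S OWN RANK CERTIFICATE `r_{n+1} = r_n` for every `n ≥ n₀(K)`;
  `classGroupPRank_cyclotomic_two_mono` (`r_a ≤ r_b` for `a ≤ b`).
* §2 `totallyRamifiedFrom_zero_of_odd_discr` (Fukuda index `0`), ★ **`classicalLambda_le_ferreroKidaSum_sub_one`** —
  **`μ₂(K) = 0 ∧ λ₂(K) ≤ Σ_{ℓ ∣ d_K} 2^{ord₂(ℓ²−1)−3} − 1`** for every cyclotomic `ℤ₂`-extension of an imaginary quadratic `K` with odd `d_K`: the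
  UPPER HALF of Ferrero's (1980) / Kida's (1979) formula `λ₂(ℚ(√−d)) = Σ − 1`, now a tree theorem (the tree's named fact
  `ferreroKida_classicalLambda_two_imaginaryQuadratic` asserts equality); the `d`-keyed form `classicalLambda_le_of_sq_eq_neg` (`K ∋ √−d`, `d ≡ 3 (mod 4)`).

HONEST SCOPE: `d_K` odd only; the LOWER bound `λ₂ ≥ Σ − 1` (no capitulation defect) is NOT proved here.  Nothing here is specific to any summit; BSD is
not proved by any of this.

## References
* B. Ferrero, *The cyclotomic ℤ₂-extension of imaginary quadratic fields*, Amer. J. Math. 102 (1980) 447–459. [Ferrero1980AJM]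
* Y. Kida, *On cyclotomic ℤ₂-extensions of imaginary quadratic fields*, Tôhoku Math. J. 31 (1979) 91–96. [Kida1979Tohoku]
* T. Fukuda, *Remarks on ℤ_p-extensions of number fields*, Proc. Japan Acad. 70 (1994), Thm. 1 (2). [Fukuda1994]
* L. C. Washington, *Introduction to Cyclotomic Fields* (1997), §13.1, §13.3. [Washington1997]
-/

set_option autoImplicit false

noncomputable section

open scoped NumberField
open NumberField IsDedekindDomain Field IntermediateField Module Ideal Finset

namespace Literature.NumberTheory.IwasawaTheory

open Literature.NumberTheory.EllipticCurves Literature.NumberTheory.EllipticCurves.ZpExtension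
  Literature.NumberTheory.GaloisRepresentations Literature.NumberTheory.NumberFields

variable (K : Type) [Field K] [NumberField K] (hK : IsImaginaryQuadratic K)

/-! ## §1 The explicit `2`-rank and its stabilisation -/

include hK in
/-- **`rank₂ Cl(K_n) = Σ_{ℓ ∣ d_K} 2^{min(n, ord₂(ℓ²−1)−3)} − 1` (and `1 ≤ Σ`)** for every `n` and every cyclotomic `ℤ₂`-extension `κK` of the imaginary
quadratic `K` with odd `d_K` (genus count + exact decomposition law). [cite: Ferrero1980AJM, §2] [cite: Kida1979Tohoku, Thm. 1 (proof)]
[cite: Washington1997, §13.1] -/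
theorem classGroupPRank_cyclotomic_two_eq_sum_two_pow_min (hd : Odd (NumberField.discr K).natAbs) (κK : ZpExtension K 2) (hκK : κK.IsCyclotomic)
    (n : ℕ) :
    classGroupPRank κK n = (∑ ℓ ∈ (NumberField.discr K).natAbs.primeFactors, 2 ^ min n (padicValNat 2 (ℓ ^ 2 - 1) - 3)) - 1 ∧
      1 ≤ ∑ ℓ ∈ (NumberField.discr K).natAbs.primeFactors, 2 ^ min n (padicValNat 2 (ℓ ^ 2 - 1) - 3) := by
  haveI : FiniteDimensional ℚ ↥((CyclotomicZp.zpExtension 2).layer n) := (CyclotomicZp.zpExtension 2).finiteDimensional_layer_holds n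
  haveI : NumberField ↥((CyclotomicZp.zpExtension 2).layer n) := NumberField.of_module_finite ℚ _
  have hcyc := CyclotomicZp.isCyclotomic_zpExtension 2
  obtain ⟨h1, h2⟩ := classGroupPRank_imaginaryQuadratic_cyclotomic_two_eq K hK hd κK hκK n
  have hsum : (∑ ℓ ∈ (NumberField.discr K).natAbs.primeFactors,
      ((Ideal.span {(ℓ : ℤ)}).primesOver (𝓞 ↥((CyclotomicZp.zpExtension 2).layer n))).ncard) =
      ∑ ℓ ∈ (NumberField.discr K).natAbs.primeFactors, 2 ^ min n (padicValNat 2 (ℓ ^ 2 - 1) - 3) := by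
    refine Finset.sum_congr rfl fun ℓ hℓ => ?_
    have hℓp : ℓ.Prime := Nat.prime_of_mem_primeFactors hℓ
    have hℓ2 : ℓ ≠ 2 := fun h => by
      rw [h] at hℓ
      exact (Nat.not_even_iff_odd.mpr hd) (even_iff_two_dvd.mpr (Nat.dvd_of_mem_primeFactors hℓ))
    exact ncard_primesOver_layer_eq_two_pow_min_padicValNat hcyc hℓp hℓ2 n
  rw [hsum] at h1 h2
  exact ⟨h1, h2⟩

include hK in
/-- **Stationary value: for `n ≥ n₀` with `ord₂(ℓ²−1) − 3 ≤ n₀` for all `ℓ ∣ d_K`, `rank₂ Cl(K_n) = Σ_{ℓ ∣ d_K} 2^{ord₂(ℓ²−1)−3} − 1`** — the Ferrero–Kida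
number. [cite: Ferrero1980AJM, §2] [cite: Kida1979Tohoku, Thm. 1] -/
theorem classGroupPRank_cyclotomic_two_eq_of_le (hd : Odd (NumberField.discr K).natAbs) (κK : ZpExtension K 2) (hκK : κK.IsCyclotomic)
    {n₀ n : ℕ} (hn₀ : ∀ ℓ ∈ (NumberField.discr K).natAbs.primeFactors, padicValNat 2 (ℓ ^ 2 - 1) - 3 ≤ n₀) (hn : n₀ ≤ n) :
    classGroupPRank κK n = (∑ ℓ ∈ (NumberField.discr K).natAbs.primeFactors, 2 ^ (padicValNat 2 (ℓ ^ 2 - 1) - 3)) - 1 ∧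
      1 ≤ ∑ ℓ ∈ (NumberField.discr K).natAbs.primeFactors, 2 ^ (padicValNat 2 (ℓ ^ 2 - 1) - 3) := by
  obtain ⟨h1, h2⟩ := classGroupPRank_cyclotomic_two_eq_sum_two_pow_min K hK hd κK hκK n
  have hsum : (∑ ℓ ∈ (NumberField.discr K).natAbs.primeFactors, 2 ^ min n (padicValNat 2 (ℓ ^ 2 - 1) - 3)) =
      ∑ ℓ ∈ (NumberField.discr K).natAbs.primeFactors, 2 ^ (padicValNat 2 (ℓ ^ 2 - 1) - 3) :=
    Finset.sum_congr rfl fun ℓ hℓ => by rw [min_eq_right ((hn₀ ℓ hℓ).trans hn)]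
  rw [hsum] at h1 h2
  exact ⟨h1, h2⟩

include hK in
/-- ★ **The resolvent's own rank certificate: `rank₂ Cl(K_{n+1}) = rank₂ Cl(K_n)` for every `n ≥ n₀(K)`** (`K` imaginary quadratic with odd `d_K`, any
cyclotomic `ℤ₂`-extension). [cite: Ferrero1980AJM, §2] [cite: Fukuda1994, Thm. 1 (2), p. 264] -/
theorem classGroupPRank_cyclotomic_two_succ_eq_of_le (hd : Odd (NumberField.discr K).natAbs) (κK : ZpExtension K 2) (hκK : κK.IsCyclotomic)
    {n₀ n : ℕ} (hn₀ : ∀ ℓ ∈ (NumberField.discr K).natAbs.primeFactors, padicValNat 2 (ℓ ^ 2 - 1) - 3 ≤ n₀) (hn : n₀ ≤ n) :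
    classGroupPRank κK (n + 1) = classGroupPRank κK n := by
  rw [(classGroupPRank_cyclotomic_two_eq_of_le K hK hd κK hκK hn₀ hn).1,
    (classGroupPRank_cyclotomic_two_eq_of_le K hK hd κK hκK hn₀ (hn.trans (Nat.le_succ n))).1]

include hK in
/-- **`rank₂ Cl(K_a) ≤ rank₂ Cl(K_b)` for `a ≤ b`** (the counts `2^{min(n, m_ℓ)}` are monotone in `n`). [cite: Ferrero1980AJM, §2] -/
theorem classGroupPRank_cyclotomic_two_mono (hd : Odd (NumberField.discr K).natAbs) (κK : ZpExtension K 2) (hκK : κK.IsCyclotomic)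
    {a b : ℕ} (hab : a ≤ b) : classGroupPRank κK a ≤ classGroupPRank κK b := by
  rw [(classGroupPRank_cyclotomic_two_eq_sum_two_pow_min K hK hd κK hκK a).1, (classGroupPRank_cyclotomic_two_eq_sum_two_pow_min K hK hd κK hκK b).1]
  refine Nat.sub_le_sub_right (Finset.sum_le_sum fun ℓ _ => Nat.pow_le_pow_right two_pos ?_) 1
  exact min_le_min_right _ hab

/-! ## §2 `λ₂(K) ≤ Σ_{ℓ ∣ d_K} 2^{ord₂(ℓ²−1)−3} − 1` -/

/-- **Fukuda index `0` for a quadratic field with odd discriminant**: `2 ∤ d_K` makes every prime of `K` above `2` unramified (`e = 1`, odd), and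
`4 ∤ [K : ℚ] = 2`, so every cyclotomic `ℤ₂`-extension of `K` is totally ramified at the dyadic primes from layer `0`
(tree `totallyRamifiedFrom_zero_of_forall_odd_ramificationIdx_of_not_four_dvd`). [cite: Washington1997, §13.1 Lemma 13.3] [cite: Fukuda1994, p. 264] -/
theorem totallyRamifiedFrom_zero_of_odd_discr (hK2 : Module.finrank ℚ K = 2) (hd : Odd (NumberField.discr K).natAbs)
    (κK : ZpExtension K 2) (hκK : κK.IsCyclotomic) : TotallyRamifiedFrom κK 0 := by
  have h4 : ¬ 4 ∣ Module.finrank ℚ K := by rw [hK2]; decide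
  have h2d : ¬ (2 : ℤ) ∣ NumberField.discr K := fun h =>
    (Nat.not_even_iff_odd.mpr hd) (even_iff_two_dvd.mpr (Int.ofNat_dvd_left.mp h))
  have hunr : Algebra.IsUnramifiedIn (𝓞 K) (Ideal.span {(2 : ℤ)}) :=
    (NumberField.not_dvd_discr_iff_isUnramifiedIn K (𝓞 K) Int.prime_two).mp h2d
  refine totallyRamifiedFrom_zero_of_forall_odd_ramificationIdx_of_not_four_dvd h4 κK hκK fun w hw => ?_
  haveI := w.isPrime
  have hlies : w.asIdeal.LiesOver (Ideal.span {((2 : ℕ) : ℤ)}) := liesOver_span_of_natCast_mem_asIdeal Nat.prime_two w hw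
  rw [(Algebra.isUnramifiedIn_iff_forall_ramificationIdx_eq_one.mp hunr) w.asIdeal (by exact_mod_cast hlies)]
  exact odd_one

include hK in
/-- ★ **The upper half of the Ferrero–Kida formula, as a theorem: `μ₂(K) = 0` and `λ₂(K) ≤ Σ_{ℓ ∣ d_K} 2^{ord₂(ℓ²−1)−3} − 1`** for every cyclotomic
`ℤ₂`-extension `κK` of an imaginary quadratic field `K` with odd `d_K` — the `2`-rank of `Cl(K_n)` is stationary at `Σ − 1` from `n₀(K)` on, a rank certificate
past the Fukuda index `0`, so Fukuda's Theorem 1 (2) bounds `λ` (tree `classicalLambda_le_of_classGroupPRank_succ_eq`). [cite: Ferrero1980AJM, Thm. (λ = Σ − 1)]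
[cite: Kida1979Tohoku, Thm. 1] [cite: Fukuda1994, Thm. 1 (2), p. 264] -/
theorem classicalLambda_le_ferreroKidaSum_sub_one (hd : Odd (NumberField.discr K).natAbs) (κK : ZpExtension K 2) (hκK : κK.IsCyclotomic) :
    ClassicalMuVanishes κK ∧
      classicalLambda κK ≤ (∑ ℓ ∈ (NumberField.discr K).natAbs.primeFactors, 2 ^ (padicValNat 2 (ℓ ^ 2 - 1) - 3)) - 1 := by
  haveI : Fact (Nat.Prime 2) := ⟨Nat.prime_two⟩
  set n₀ := (NumberField.discr K).natAbs.primeFactors.sup (fun ℓ => padicValNat 2 (ℓ ^ 2 - 1) - 3) with hn₀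
  have hn₀' : ∀ ℓ ∈ (NumberField.discr K).natAbs.primeFactors, padicValNat 2 (ℓ ^ 2 - 1) - 3 ≤ n₀ := fun ℓ hℓ =>
    Finset.le_sup (f := fun ℓ => padicValNat 2 (ℓ ^ 2 - 1) - 3) hℓ
  have hcert := classGroupPRank_cyclotomic_two_succ_eq_of_le K hK hd κK hκK hn₀' le_rfl
  obtain ⟨hμ, hle⟩ := classicalLambda_le_of_classGroupPRank_succ_eq κK (totallyRamifiedFrom_zero_of_odd_discr K hK.1 hd κK hκK)
    (Nat.zero_le n₀) hcert
  rw [(classGroupPRank_cyclotomic_two_eq_of_le K hK hd κK hκK hn₀' le_rfl).1] at hle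
  exact ⟨hμ, hle⟩

/-- **`d`-keyed form**: `K ∋ η` with `η² = −d`, `d ≡ 3 (mod 4)` squarefree, `[K:ℚ] = 2`, `κK` any cyclotomic `ℤ₂`-extension:
**`μ₂(K) = 0` and `λ₂(K) ≤ Σ_{ℓ ∣ d} 2^{ord₂(ℓ²−1)−3} − 1`**; and `rank₂ Cl(K_n) = Σ_{ℓ ∣ d} 2^{min(n, ord₂(ℓ²−1)−3)} − 1` for every `n`.
[cite: Ferrero1980AJM, Thm.] [cite: Kida1979Tohoku, Thm. 1] [cite: Fukuda1994, Thm. 1 (2), p. 264] -/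
theorem classicalLambda_le_of_sq_eq_neg (hK2 : Module.finrank ℚ K = 2) {d : ℕ} (hsf : Squarefree d) (hd4 : d % 4 = 3)
    (hη : ∃ η : K, η ^ 2 = -((d : ℕ) : K)) (κK : ZpExtension K 2) (hκK : κK.IsCyclotomic) :
    (ClassicalMuVanishes κK ∧ classicalLambda κK ≤ (∑ ℓ ∈ d.primeFactors, 2 ^ (padicValNat 2 (ℓ ^ 2 - 1) - 3)) - 1) ∧
      ∀ n : ℕ, classGroupPRank κK n = (∑ ℓ ∈ d.primeFactors, 2 ^ min n (padicValNat 2 (ℓ ^ 2 - 1) - 3)) - 1 := by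
  obtain ⟨hIQ, hnat, hodd⟩ := isImaginaryQuadratic_and_natAbs_discr_eq_of_sq_eq_neg K hK2 hsf hd4 hη
  have h1 := classicalLambda_le_ferreroKidaSum_sub_one K hIQ hodd κK hκK
  have h2 := fun n => (classGroupPRank_cyclotomic_two_eq_sum_two_pow_min K hIQ hodd κK hκK n).1
  rw [hnat] at h1 h2
  exact ⟨h1, h2⟩

end Literature.NumberTheory.IwasawaTheory

end
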